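import Summits.QuantumAdvantage.QuantumAdvantage.Theorems.ArithStatLadderIqThreeNotPPolyClassNumberSharpP
import Summits.QuantumAdvantage.QuantumAdvantage.Theorems.IqThreeMemBQP.Negative.RefutationCost
import Literature.Computability.QuantumComplexity.GapPRing
import Literature.Computability.Complexity.SharpPClosure
import Literature.Computability.Complexity.StackBricksStrings
import Literature.Computability.Complexity.FoldBricks

/-!
# `IQ3 ∈ P^{#P}`: the class number mod `3` on fundamental discriminants with ONE `#P` query

Helper file for the crux `ArithStatLadder.IqThreeNotPPoly` (stmt-QuantumAdvantage-2422, `IQ3 ∉ P/poly`,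
`IQ3 = bin {d : −d fundamental, 3 ∣ h(−d)}`), line `Sketch`, continuation lead c3 — part 4, independent of part 3
(`…MemPSPACE.lean`, which places `IQ3` in `PSPACE`; the three small lemmas both files need are
repeated here as `private` copies so that the two files build in parallel). This file places `IQ3` in
Valiant's **`P^{#P}`** (`iqThreeLang_mem_PSharpP`), the class the disprover's work file names for it ("an
explicit `P^{#P}` language"): a polynomial-time machine asking ONE query to the `#P` function

  `F(x) = h(−⟦x⟧) + 2^{A} · (S(x) + 2^{A} · S(bin (⟦x⟧/4)))`,   `A = 3(|x|+1) + 1`,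

where `h(−⟦x⟧) ∈ #P` is part 2 (`classNumber_negVal_mem_SharpP`) and
`S(w) = #{y ∈ {0,1}^{|w|} : 2 ≤ ⟦y⟧, ⟦y⟧² ∣ ⟦w⟧} ∈ #P` counts square divisors (`exists_sqDivCount_sharpP`;
`S(w) = 0 ↔ ⟦w⟧ squarefree` for `⟦w⟧ ≠ 0`, `cnt_sqDiv_eq_zero_iff`); `F ∈ #P` by the tree's ring
closure of `#P` (`add_mem_SharpP`, `mul_mem_SharpP`, `two_pow_mem_SharpP`, `comp_mem_SharpP`). The three
fields of `bin F(x)` are read back by `take`/`drop` at the unary length `1^A` (`h < 2^A`, `S ≤ 2^{|x|}`),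
and the post-processing `x canonical ∧ ((⟦x⟧ ≡ 3 (4) ∧ S = 0) ∨ (⟦x⟧ ≡ 4, 8 (16) ∧ S₄ = 0)) ∧ 3 ∣ h`
is a `P` test (part 1's brick compiler), so `IQ3 ∈ P^F ⊆ P^{#P}` (`mem_PRel_ofFun_of_oneQuery`).

Consequences: `IqThreeNotPPoly → P^{#P} ⊄ P/poly` (`PSharpP_not_subset_PPoly_of_iqThreeNotPPoly`);
`¬ IqThreeMemBQP → P ≠ P^{#P}`; `IqThreeNotBPP → BPP ≠ P^{#P}`. No definition is introduced.
Sorry-free; axioms ⊆ {propext, Classical.choice, Quot.sound}.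

References: L. G. Valiant, *The complexity of computing the permanent*, TCS 8 (1979), §2;
S. Arora, B. Barak, *Computational Complexity*, CUP 2009, Def. 17.5 (`P^{#P}`), §17.2;
S. Fenner, L. Fortnow, S. Kurtz, *Gap-definable counting classes*, JCSS 48 (1994), §3 (closure of
`#P` under sums and products); H. Cohen, *A Course in Computational Algebraic Number Theory*, 1993,
§5.3 (counting reduced forms).
-/

noncomputable section

set_option linter.dupNamespace false

namespace Summit.QuantumAdvantage.QuantumAdvantage.Theorems.IqThreeNotPPoly

open _root_.Computability Polynomial
open Literature.Computability.Complexity Literature.Computability.Complexity.Brick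
open Literature.Computability.Complexity.Classes (P)
open Literature.Computability.Cryptography (IsNegFundamentalDiscr BQP)
open Literature.Computability.QuantumComplexity.AWPPPP (add_mem_SharpP two_pow_mem_SharpP)
open Literature.Computability.QuantumComplexity.GapPRing (mul_mem_SharpP)
open Literature.NumberTheory.QuadraticFields
open Summit.QuantumAdvantage.QuantumAdvantage.Theses.ArithStatLadder (IqThreeNotPPoly IqThreeMemBQP IqThreeNotBPP)

/-! ### More compiler pieces (part 1 continued): the witness value, remainders, `Q`-blocks, canonicity -/

/-- The second component `⟦y⟧` is a numeral expression. -/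
theorem pairNat_snd : ∃ f ∈ FP, ∀ w y : List Bool, bitsToNat (f (boolPair w y)) = bitsToNat y :=
  ⟨sndF, sndF_mem_FP, fun w y => by rw [sndF_boolPair]⟩

/-- Remainders of numeral expressions (`remFn`). -/
theorem pairNat_rem {φ ψ : List Bool → List Bool → ℕ}
    (hφ : ∃ f ∈ FP, ∀ w y : List Bool, bitsToNat (f (boolPair w y)) = φ w y)
    (hψ : ∃ f ∈ FP, ∀ w y : List Bool, bitsToNat (f (boolPair w y)) = ψ w y) :
    ∃ f ∈ FP, ∀ w y : List Bool, bitsToNat (f (boolPair w y)) = φ w y % ψ w y := by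
  obtain ⟨p, hp, hpv⟩ := hφ
  obtain ⟨q, hq, hqv⟩ := hψ
  exact ⟨remFn ∘ fanoutFn p q, comp_mem_FP remFn_mem_FP (fanoutFn_mem_FP hp hq), fun w y => by
    rw [Function.comp_apply, fanoutFn_apply, remFn_boolPair, bitsToNat_encodeNat, hpv, hqv]⟩

/-- The block `y ↾ Q(|w|)` for a polynomial `Q`: its value is a numeral expression. -/
theorem pairNat_takeQ (Q : Polynomial ℕ) : ∃ f ∈ FP, ∀ w y : List Bool,
    bitsToNat (f (boolPair w y)) = bitsToNat (y.take (Q.eval w.length)) := by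
  refine ⟨Plumb.takeFn ∘ fanoutFn (Plumb.polyFn Q ∘ fstF) sndF,
    comp_mem_FP Plumb.takeFn_mem_FP (fanoutFn_mem_FP
      (comp_mem_FP (Plumb.polyFn_mem_FP _) fstF_mem_FP) sndF_mem_FP), fun w y => ?_⟩
  rw [Function.comp_apply, fanoutFn_apply, Function.comp_apply, fstF_boolPair, sndF_boolPair,
    Plumb.polyFn_apply, Plumb.takeFn_boolPair]
  simp [ones]

/-- The tail `y ⇂ Q(|w|)` is an `FP` function of `⟨w, y⟩`. -/
theorem exists_pairRestQFn (Q : Polynomial ℕ) : ∃ f ∈ FP, ∀ w y : List Bool,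
    f (boolPair w y) = y.drop (Q.eval w.length) := by
  refine ⟨Plumb.dropFn ∘ fanoutFn (Plumb.polyFn Q ∘ fstF) sndF,
    comp_mem_FP Plumb.dropFn_mem_FP (fanoutFn_mem_FP
      (comp_mem_FP (Plumb.polyFn_mem_FP _) fstF_mem_FP) sndF_mem_FP), fun w y => ?_⟩
  rw [Function.comp_apply, fanoutFn_apply, Function.comp_apply, fstF_boolPair, sndF_boolPair,
    Plumb.polyFn_apply, Plumb.dropFn_boolPair]
  simp [ones]

/-- The block `(y ⇂ Q(|w|)) ↾ Q(|w|)`: its value is a numeral expression. -/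
theorem pairNat_dropTakeQ (Q : Polynomial ℕ) : ∃ f ∈ FP, ∀ w y : List Bool,
    bitsToNat (f (boolPair w y)) = bitsToNat ((y.drop (Q.eval w.length)).take (Q.eval w.length)) := by
  obtain ⟨r, hr, hrv⟩ := exists_pairRestQFn Q
  refine ⟨Plumb.takeFn ∘ fanoutFn (Plumb.polyFn Q ∘ fstF) r,
    comp_mem_FP Plumb.takeFn_mem_FP (fanoutFn_mem_FP
      (comp_mem_FP (Plumb.polyFn_mem_FP _) fstF_mem_FP) hr), fun w y => ?_⟩
  rw [Function.comp_apply, fanoutFn_apply, Function.comp_apply, fstF_boolPair, hrv,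
    Plumb.polyFn_apply, Plumb.takeFn_boolPair]
  simp [ones]

/-- The block `(y ⇂ Q(|w|)) ⇂ Q(|w|)`: its value is a numeral expression. -/
theorem pairNat_dropDropQ (Q : Polynomial ℕ) : ∃ f ∈ FP, ∀ w y : List Bool,
    bitsToNat (f (boolPair w y)) = bitsToNat ((y.drop (Q.eval w.length)).drop (Q.eval w.length)) := by
  obtain ⟨r, hr, hrv⟩ := exists_pairRestQFn Q
  refine ⟨Plumb.dropFn ∘ fanoutFn (Plumb.polyFn Q ∘ fstF) r,
    comp_mem_FP Plumb.dropFn_mem_FP (fanoutFn_mem_FP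
      (comp_mem_FP (Plumb.polyFn_mem_FP _) fstF_mem_FP) hr), fun w y => ?_⟩
  rw [Function.comp_apply, fanoutFn_apply, Function.comp_apply, fstF_boolPair, hrv,
    Plumb.polyFn_apply, Plumb.dropFn_boolPair]
  simp [ones]

/-- Canonicity of the first component, `bin ⟦w⟧ = w`, is a test (`addFn ⟨w, ε⟩ = bin ⟦w⟧`,
string equality `eqPairFn`). -/
theorem pairTest_canonFst : ∃ f ∈ FP, OneBit f ∧ ∀ w y : List Bool,
    f (boolPair w y) = [true] ↔ encodeNat (bitsToNat w) = w := by
  refine ⟨eqPairFn ∘ fanoutFn (addFn ∘ fanoutFn fstF (fun _ => [])) fstF,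
    comp_mem_FP eqPairFn_mem_FP (fanoutFn_mem_FP (comp_mem_FP addFn_mem_FP
      (fanoutFn_mem_FP fstF_mem_FP (const_mem_FP _))) fstF_mem_FP),
    fun z => by rcases eqPairFn_eq_or (fanoutFn (addFn ∘ fanoutFn fstF (fun _ => [])) fstF z) with h | h <;>
      exact ⟨_, h⟩, fun w y => ?_⟩
  rw [Function.comp_apply, fanoutFn_apply, Function.comp_apply, fanoutFn_apply, fstF_boolPair,
    addFn_boolPair, bitsToNat_nil, Nat.add_zero, eqPairFn_boolPair, List.cons.injEq, decide_eq_true_iff]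
  exact and_iff_left rfl

/-! ### Three lemmas shared with part 3 (private copies) -/

/-- The witness bound `h(−⟦w⟧) ≤ 2^{3(|w|+1)}` (copy of part 3's `classNumber_negVal_le_two_pow`). -/
private theorem classNumber_negVal_le_two_pow_copy (w : List Bool) :
    BinaryQuadraticForm.classNumber (-(bitsToNat w : ℤ)) ≤ 2 ^ (3 * (w.length + 1)) := by
  obtain ⟨R, -, h⟩ := exists_classNumber_relation
  rw [← h w, PPSharpP.countWitnesses_eq_cnt]
  exact cnt_le _ _

/-- The route's fundamentality literal over `ℕ` (copy of part 3's `isNegFundamentalDiscr_iff_nat`):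
`−d` is fundamental iff `d ≡ 3 (mod 4)` is squarefree, or `d ≡ 4, 8 (mod 16)` with `d/4` squarefree. -/
private theorem isNegFundamentalDiscr_iff_nat_copy (d : ℕ) : IsNegFundamentalDiscr d ↔
    (d % 4 = 3 ∧ Squarefree d) ∨ ((d % 16 = 4 ∨ d % 16 = 8) ∧ Squarefree (d / 4)) := by
  have hsq : ∀ n : ℕ, Squarefree (-(n : ℤ)) ↔ Squarefree n := fun n => by
    rw [← Int.squarefree_natAbs, Int.natAbs_neg, Int.natAbs_natCast]
  unfold IsNegFundamentalDiscr
  constructor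
  · rintro (⟨h1, hsf, -⟩ | ⟨h4, hres, hsf⟩)
    · exact Or.inl ⟨by omega, (hsq d).1 hsf⟩
    · right
      obtain ⟨k, rfl⟩ : ∃ k : ℕ, d = 4 * k := ⟨d / 4, by omega⟩
      have hq : (-((4 * k : ℕ) : ℤ)) / 4 = -(k : ℤ) := by push_cast; omega
      rw [hq] at hres hsf
      rw [Nat.mul_div_cancel_left k (by norm_num)]
      exact ⟨by omega, (hsq k).1 hsf⟩
  · rintro (⟨h3, hsf⟩ | ⟨h16, hsf⟩)
    · exact Or.inl ⟨by omega, (hsq d).2 hsf, by omega⟩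
    · right
      obtain ⟨k, rfl⟩ : ∃ k : ℕ, d = 4 * k := ⟨d / 4, by omega⟩
      rw [Nat.mul_div_cancel_left k (by norm_num)] at hsf
      have hq : (-((4 * k : ℕ) : ℤ)) / 4 = -(k : ℤ) := by push_cast; omega
      rw [hq]
      refine ⟨?_, by omega, (hsq k).2 hsf⟩
      push_cast
      exact dvd_neg.2 (dvd_mul_right 4 _)

/-- `IQ3 = NUM ⊓ (FUND ⊓ THREE)` as languages (copy of part 3's `iqThreeLang_eq_inter`). -/
private theorem iqThreeLang_eq_inter_copy :
    encodingNatBool.toLanguage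
        {d : ℕ | IsNegFundamentalDiscr d ∧ 3 ∣ BinaryQuadraticForm.classNumber (-(d : ℤ))} =
      {w : List Bool | encodeNat (bitsToNat w) = w} ⊓
        ({w : List Bool | IsNegFundamentalDiscr (bitsToNat w)} ⊓
          {w : List Bool | 3 ∣ BinaryQuadraticForm.classNumber (-(bitsToNat w : ℤ))}) := by
  ext w
  constructor
  · rintro ⟨d, ⟨hF, h3⟩, rfl⟩
    change encodeNat (bitsToNat (encodeNat d)) = encodeNat d ∧
      IsNegFundamentalDiscr (bitsToNat (encodeNat d)) ∧
        3 ∣ BinaryQuadraticForm.classNumber (-(bitsToNat (encodeNat d) : ℤ))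
    rw [bitsToNat_encodeNat]
    exact ⟨rfl, hF, h3⟩
  · rintro ⟨hN, hF, h3⟩
    change encodeNat (bitsToNat w) = w at hN
    exact ⟨bitsToNat w, ⟨hF, h3⟩, hN⟩

/-! ### The square-divisor count `S ∈ #P` -/

/-- **The square-divisor count is a `#P` function**: `S(w) = #{y ∈ {0,1}^{|w|} : 2 ≤ ⟦y⟧ ∧ ⟦y⟧² ∣ ⟦w⟧}`
(divisibility as `⟦w⟧ mod ⟦y⟧² = 0`). -/
theorem exists_sqDivCount_sharpP : ∃ S ∈ SharpP, ∀ w : List Bool,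
    S w = cnt w.length {y : List Bool | 2 ≤ bitsToNat y ∧ bitsToNat w % (bitsToNat y * bitsToNat y) = 0} := by
  obtain ⟨V, hV, h1, hVal⟩ := pairTest_and (pairTest_le (pairNat_const 2) pairNat_snd)
    (pairTest_eq (pairNat_rem pairNat_fst (pairNat_mul pairNat_snd pairNat_snd)) (pairNat_const 0))
  have hR : ({z | V z = [true]} : Language Bool) ∈ Classes.P :=
    mem_P_of_mem_FP hV _ fun z => ⟨id, fun hz => by
      obtain ⟨b, hb⟩ := h1 z
      cases b
      · exact hb
      · exact absurd hb hz⟩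
  refine ⟨fun w => countWitnesses {z | V z = [true]} ((X : Polynomial ℕ).eval w.length) w,
    ⟨{z | V z = [true]}, hR, X, fun w => rfl⟩, fun w => ?_⟩
  show countWitnesses {z | V z = [true]} ((X : Polynomial ℕ).eval w.length) w = _
  rw [eval_X, PPSharpP.countWitnesses_eq_cnt]
  exact cnt_congr fun y _ => hVal w y

/-- A non-squarefree `m ≠ 0` has a prime square factor `p² ∣ m` with `2 ≤ p ≤ m`. -/
theorem exists_prime_sq_dvd_of_not_squarefree {m : ℕ} (hm : ¬ Squarefree m) (h0 : m ≠ 0) :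
    ∃ p : ℕ, 2 ≤ p ∧ p * p ∣ m ∧ p ≤ m := by
  obtain ⟨p, hp, hpm⟩ : ∃ p : ℕ, p.Prime ∧ p * p ∣ m := by
    by_contra hcon
    exact hm (Nat.squarefree_iff_prime_squarefree.2 fun p hp h => hcon ⟨p, hp, h⟩)
  exact ⟨p, hp.two_le, hpm, Nat.le_of_dvd (Nat.pos_of_ne_zero h0) (dvd_trans (Dvd.intro p rfl) hpm)⟩

/-- **`S(w) = 0 ↔ ⟦w⟧ is squarefree`** (for `⟦w⟧ ≠ 0`; a prime square factor `p ≤ ⟦w⟧ < 2^{|w|}`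
is the `|w|`-bit witness `natToWord |w| p`). -/
theorem cnt_sqDiv_eq_zero_iff (w : List Bool) (h0 : bitsToNat w ≠ 0) :
    cnt w.length {y : List Bool | 2 ≤ bitsToNat y ∧ bitsToNat w % (bitsToNat y * bitsToNat y) = 0} = 0 ↔
      Squarefree (bitsToNat w) := by
  classical
  unfold cnt
  rw [Finset.card_eq_zero, Finset.eq_empty_iff_forall_notMem]
  constructor
  · intro h
    by_contra hsq
    obtain ⟨p, hp2, hpm, hple⟩ := exists_prime_sq_dvd_of_not_squarefree hsq h0
    have hpl : p < 2 ^ w.length := lt_of_le_of_lt hple (bitsToNat_lt w)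
    refine h ⟨natToWord w.length p, length_natToWord _ _⟩ ?_
    simp only [Finset.mem_filter, Finset.mem_univ, true_and, List.Vector.toList_mk, Set.mem_setOf_eq,
      bitsToNat_natToWord_of_lt hpl]
    exact ⟨hp2, Nat.mod_eq_zero_of_dvd hpm⟩
  · intro hsq r hr
    simp only [Finset.mem_filter, Finset.mem_univ, true_and, Set.mem_setOf_eq] at hr
    obtain ⟨h2, hd⟩ := hr
    have h1 : bitsToNat r.toList = 1 := Nat.isUnit_iff.1 (hsq _ (Nat.dvd_of_mod_eq_zero hd))
    omega

/-! ### The post-processing test and its reading on the packed answer -/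

/-- **The post-processing** `D ∈ P`-test on `⟨x, u⟩`, `A = 3(|x|+1)+1`, fields `hh = ⟦u ↾ A⟧`,
`s = ⟦(u ⇂ A) ↾ A⟧`, `s₄ = ⟦(u ⇂ A) ⇂ A⟧`:
`bin ⟦x⟧ = x ∧ ((⟦x⟧ % 4 = 3 ∧ s = 0) ∨ ((⟦x⟧ % 16 = 4 ∨ ⟦x⟧ % 16 = 8) ∧ s₄ = 0)) ∧ hh % 3 = 0`. -/
theorem exists_postTest : ∃ V ∈ FP, OneBit V ∧ ∀ x u : List Bool, V (boolPair x u) = [true] ↔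
    (encodeNat (bitsToNat x) = x ∧
      ((bitsToNat x % 4 = 3 ∧
          bitsToNat ((u.drop ((3 * (X + 1) + 1 : Polynomial ℕ).eval x.length)).take
            ((3 * (X + 1) + 1 : Polynomial ℕ).eval x.length)) = 0) ∨
        ((bitsToNat x % 16 = 4 ∨ bitsToNat x % 16 = 8) ∧
          bitsToNat ((u.drop ((3 * (X + 1) + 1 : Polynomial ℕ).eval x.length)).drop
            ((3 * (X + 1) + 1 : Polynomial ℕ).eval x.length)) = 0)) ∧
      bitsToNat (u.take ((3 * (X + 1) + 1 : Polynomial ℕ).eval x.length)) % 3 = 0) :=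
  pairTest_and pairTest_canonFst (pairTest_and
    (pairTest_or
      (pairTest_and (pairTest_eq (pairNat_rem pairNat_fst (pairNat_const 4)) (pairNat_const 3))
        (pairTest_eq (pairNat_dropTakeQ (3 * (X + 1) + 1)) (pairNat_const 0)))
      (pairTest_and (pairTest_or (pairTest_eq (pairNat_rem pairNat_fst (pairNat_const 16)) (pairNat_const 4))
        (pairTest_eq (pairNat_rem pairNat_fst (pairNat_const 16)) (pairNat_const 8)))
        (pairTest_eq (pairNat_dropDropQ (3 * (X + 1) + 1)) (pairNat_const 0))))
    (pairTest_eq (pairNat_rem (pairNat_takeQ (3 * (X + 1) + 1)) (pairNat_const 3)) (pairNat_const 0)))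

/-- Reading the three fields of a packed numeral `bin (h + 2^A (s + 2^A s₄))` with `h, s < 2^A`. -/
theorem fields_of_packed {A h s s₄ : ℕ} (hh : h < 2 ^ A) (hs : s < 2 ^ A) :
    bitsToNat ((encodeNat (h + 2 ^ A * (s + 2 ^ A * s₄))).take A) = h ∧
    bitsToNat (((encodeNat (h + 2 ^ A * (s + 2 ^ A * s₄))).drop A).take A) = s ∧
    bitsToNat (((encodeNat (h + 2 ^ A * (s + 2 ^ A * s₄))).drop A).drop A) = s₄ := by
  have hpos : 0 < 2 ^ A := Nat.two_pow_pos A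
  have e1 : (h + 2 ^ A * (s + 2 ^ A * s₄)) / 2 ^ A = s + 2 ^ A * s₄ := by
    rw [Nat.add_mul_div_left _ _ hpos, Nat.div_eq_of_lt hh, Nat.zero_add]
  have e2 : (s + 2 ^ A * s₄) / 2 ^ A = s₄ := by
    rw [Nat.add_mul_div_left _ _ hpos, Nat.div_eq_of_lt hs, Nat.zero_add]
  refine ⟨?_, ?_, ?_⟩
  · rw [bitsToNat_take, bitsToNat_encodeNat, Nat.add_mul_mod_self_left, Nat.mod_eq_of_lt hh]
  · rw [bitsToNat_take, bitsToNat_drop, bitsToNat_encodeNat, e1, Nat.add_mul_mod_self_left,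
      Nat.mod_eq_of_lt hs]
  · rw [bitsToNat_drop, bitsToNat_drop, bitsToNat_encodeNat, e1, e2]

/-! ### `IQ3 ∈ P^{#P}` -/

/-- **`IQ3 ∈ P^{#P}`**: one query to the `#P` function `F(x) = h(−⟦x⟧) + 2^A (S(x) + 2^A S(bin (⟦x⟧/4)))`,
`A = 3(|x|+1)+1`, then the `P` post-processing `exists_postTest`. -/
theorem iqThreeLang_mem_PSharpP' :
    encodingNatBool.toLanguage
      {d : ℕ | IsNegFundamentalDiscr d ∧ 3 ∣ BinaryQuadraticForm.classNumber (-(d : ℤ))} ∈ PSharpP := by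
  obtain ⟨S, hS, hSv⟩ := exists_sqDivCount_sharpP
  -- the `FP` map `x ↦ bin (⟦x⟧ / 4)`
  have hg : (divFn ∘ fanoutFn (fun w => w) (fun _ => encodeNat 4)) ∈ FP :=
    comp_mem_FP divFn_mem_FP (fanoutFn_mem_FP OracleCompose.id_mem_FP (const_mem_FP _))
  have hgv : ∀ x, (divFn ∘ fanoutFn (fun w => w) (fun _ => encodeNat 4)) x = encodeNat (bitsToNat x / 4) :=
    fun x => by rw [Function.comp_apply, fanoutFn_apply, divFn_boolPair, bitsToNat_encodeNat]
  -- the packed `#P` function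
  set F : List Bool → ℕ := fun x => BinaryQuadraticForm.classNumber (-(bitsToNat x : ℤ)) +
      2 ^ (3 * (X + 1) + 1 : Polynomial ℕ).eval x.length *
        (S x + 2 ^ (3 * (X + 1) + 1 : Polynomial ℕ).eval x.length *
          (S ∘ (divFn ∘ fanoutFn (fun w => w) (fun _ => encodeNat 4))) x) with hFdef
  have hF : F ∈ SharpP := by
    rw [hFdef]
    exact add_mem_SharpP classNumber_negVal_mem_SharpP (mul_mem_SharpP (two_pow_mem_SharpP _)
      (add_mem_SharpP hS (mul_mem_SharpP (two_pow_mem_SharpP _) (comp_mem_SharpP hS hg))))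
  -- the post-processing
  obtain ⟨V, hV, h1, hVal⟩ := exists_postTest
  have hD : ({z | V z = [true]} : Language Bool) ∈ Classes.P :=
    mem_P_of_mem_FP hV _ fun z => ⟨id, fun hz => by
      obtain ⟨b, hb⟩ := h1 z
      cases b
      · exact hb
      · exact absurd hb hz⟩
  set L : Language Bool := encodingNatBool.toLanguage
      {d : ℕ | IsNegFundamentalDiscr d ∧ 3 ∣ BinaryQuadraticForm.classNumber (-(d : ℤ))} with hLdef
  -- the reading: `x ∈ IQ3 ↔ ⟨x, bin F(x)⟩ ∈ D`
  have hread : ∀ x : List Bool, x ∈ L ↔ boolPair x (encodeNat (F x)) ∈ ({z | V z = [true]} : Language Bool) := by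
    intro x
    have hA : BinaryQuadraticForm.classNumber (-(bitsToNat x : ℤ)) <
        2 ^ (3 * (X + 1) + 1 : Polynomial ℕ).eval x.length := by
      have := classNumber_negVal_le_two_pow_copy x
      have hpos : 0 < 2 ^ (3 * (x.length + 1)) := Nat.two_pow_pos _
      have e : (3 * (X + 1) + 1 : Polynomial ℕ).eval x.length = 3 * (x.length + 1) + 1 := by simp
      rw [e, pow_succ]
      omega
    have hSle : S x < 2 ^ (3 * (X + 1) + 1 : Polynomial ℕ).eval x.length := by
      rw [hSv]
      have := cnt_le x.length
        {y : List Bool | 2 ≤ bitsToNat y ∧ bitsToNat x % (bitsToNat y * bitsToNat y) = 0}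
      have e : (3 * (X + 1) + 1 : Polynomial ℕ).eval x.length = 3 * (x.length + 1) + 1 := by simp
      rw [e]
      calc _ ≤ 2 ^ x.length := this
        _ < 2 ^ (3 * (x.length + 1) + 1) := Nat.pow_lt_pow_right (by norm_num) (by omega)
    obtain ⟨f1, f2, f3⟩ := fields_of_packed
      (s₄ := (S ∘ (divFn ∘ fanoutFn (fun w => w) (fun _ => encodeNat 4))) x) hA hSle
    rw [hLdef, iqThreeLang_eq_inter_copy, hFdef]
    change (encodeNat (bitsToNat x) = x ∧ IsNegFundamentalDiscr (bitsToNat x) ∧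
        3 ∣ BinaryQuadraticForm.classNumber (-(bitsToNat x : ℤ))) ↔
      V (boolPair x (encodeNat (BinaryQuadraticForm.classNumber (-(bitsToNat x : ℤ)) +
        2 ^ (3 * (X + 1) + 1 : Polynomial ℕ).eval x.length *
          (S x + 2 ^ (3 * (X + 1) + 1 : Polynomial ℕ).eval x.length *
            (S ∘ (divFn ∘ fanoutFn (fun w => w) (fun _ => encodeNat 4))) x)))) = [true]
    rw [hVal, f1, f2, f3, Function.comp_apply, hgv, hSv, hSv, isNegFundamentalDiscr_iff_nat_copy]
    constructor
    · rintro ⟨hc, hF', h3⟩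
      refine ⟨hc, ?_, Nat.mod_eq_zero_of_dvd h3⟩
      rcases hF' with ⟨h4, hsf⟩ | ⟨h16, hsf⟩
      · exact Or.inl ⟨h4, (cnt_sqDiv_eq_zero_iff x (by omega)).2 hsf⟩
      · exact Or.inr ⟨h16, (cnt_sqDiv_eq_zero_iff (encodeNat (bitsToNat x / 4))
          (by rw [bitsToNat_encodeNat]; omega)).2 (by rwa [bitsToNat_encodeNat])⟩
    · rintro ⟨hc, hF', h3⟩
      refine ⟨hc, ?_, Nat.dvd_of_mod_eq_zero h3⟩
      rcases hF' with ⟨h4, hs⟩ | ⟨h16, hs⟩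
      · exact Or.inl ⟨h4, (cnt_sqDiv_eq_zero_iff x (by omega)).1 hs⟩
      · refine Or.inr ⟨h16, ?_⟩
        have := (cnt_sqDiv_eq_zero_iff (encodeNat (bitsToNat x / 4))
          (by rw [bitsToNat_encodeNat]; omega)).1 hs
        rwa [bitsToNat_encodeNat] at this
  show L ∈ ⋃ f ∈ SharpP, PRel (Oracle.ofFun f)
  exact Set.mem_biUnion hF (PPSharpP.mem_PRel_ofFun_of_oneQuery hD F hread)

/-- **`IQ3 ∈ P^{#P}`**, stated over the route file's literal set. -/
theorem iqThreeLang_mem_PSharpP :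
    encodingNatBool.toLanguage {d : ℕ | (((-(d:ℤ)) % 4 = 1 ∧ Squarefree (-(d:ℤ)) ∧ (-(d:ℤ)) ≠ 1) ∨ (4 ∣ (-(d:ℤ)) ∧ ((-(d:ℤ)) / 4 % 4 = 2 ∨ (-(d:ℤ)) / 4 % 4 = 3) ∧ Squarefree ((-(d:ℤ)) / 4))) ∧ 3 ∣ Literature.NumberTheory.QuadraticFields.BinaryQuadraticForm.classNumber (-(d:ℤ))} ∈ PSharpP :=
  iqThreeLang_mem_PSharpP'

/-! ### Consequences -/

/-- **The crux separates `P^{#P}` from `P/poly`**: `IqThreeNotPPoly → ¬ P^{#P} ⊆ P/poly`. -/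
theorem PSharpP_not_subset_PPoly_of_iqThreeNotPPoly (h : IqThreeNotPPoly) : ¬ PSharpP ⊆ PPoly :=
  fun hsub => h (hsub iqThreeLang_mem_PSharpP)

/-- A refutation of crux 2424 (`IQ3 ∈ BQP`) separates `P` from `P^{#P}` (tree theorem `P ⊆ BQP`). -/
theorem P_ne_PSharpP_of_not_iqThreeMemBQP (h : ¬ IqThreeMemBQP) : P ≠ PSharpP :=
  fun hEq => IqThreeMemBQP.Negative.not_mem_P_of_not_iqThreeMemBQP h (hEq ▸ iqThreeLang_mem_PSharpP')

/-- The binder `IqThreeNotBPP` (`IQ3 ∉ BPP`) separates `BPP` from `P^{#P}`. -/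
theorem BPP_ne_PSharpP_of_iqThreeNotBPP (h : IqThreeNotBPP) : BPP ≠ PSharpP :=
  fun hEq => h (hEq ▸ iqThreeLang_mem_PSharpP)

end Summit.QuantumAdvantage.QuantumAdvantage.Theorems.IqThreeNotPPoly

end
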